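import Literature.FieldTheory.AlgClosed.AutomorphismExtension
import Mathlib.FieldTheory.Minpoly.IsConjRoot
import Mathlib.RingTheory.Algebraic.Cardinality
import Mathlib.Algebra.Polynomial.Expand
import HarnessLib

/-!
# The fixed field of `Aut(ℂ/F)` is `F`, for a countable subfield `F ⊆ ℂ`

Topic `FieldTheory/AlgClosed`; a proofs-only sequel (theorems only, no definitions, no named facts)
of `AutomorphismExtension.lean`, which proves that any two embeddings of a countable field into `ℂ`
differ by an automorphism of `ℂ` (`exists_ringEquiv_apply_eq`).  Here we record the two standard
consequences used whenever a descent argument "let `σ` be an automorphism of `ℂ` fixing `F` …"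
is run over a number field `F ⊂ ℂ` rather than over `ℚ` (e.g. complex multiplication: the values
`j(τ)`, `Φ_N(τ)` at CM points are shown to lie in a class field `H ⊂ ℂ` by checking that they are
fixed by `Aut(ℂ/H)`; Lang, *Elliptic Functions*, Ch. 10 §1 [Lang1987]; Shimura, *Introduction to the
arithmetic theory of automorphic functions*, §6.8; Cox, *Primes of the form x² + ny²*, proof of
Thm. 10.23 for `F = ℚ`):

* `Complex.exists_ringEquiv_apply_eq_of_subfield` — every ring homomorphism `φ : F → ℂ` of a
  countable subfield `F ⊆ ℂ` is the restriction of an automorphism of `ℂ`;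
* `Complex.exists_ringEquiv_fix_apply_ne` — for a countable subfield `F ⊆ ℂ` and `z ∉ F` there is
  an automorphism of `ℂ` fixing `F` pointwise and moving `z`; equivalently
  (`Complex.mem_subfield_of_forall_ringEquiv`) **the fixed field of `Aut(ℂ/F)` is `F`**
  (Lang, *Algebra*, Ch. VIII §1 with Ch. V §2: if `z` is algebraic over `F`, `z ∉ F`, the
  `F`-embedding `F(z) → ℂ` onto a second root of the minimal polynomial extends to `ℂ`; if `z` is
  transcendental over `F` it is algebraic of degree `2` over the countable field `F(z²) ∌ z`, and the
  first case applies over `F(z²)`);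
* `Subfield.cardinalMk_le_aleph0_of_isAlgebraic` — a subfield of `ℂ` algebraic over `ℚ` (e.g. a
  number field embedded in `ℂ`) is countable, so the above apply to it.

Mathlib (pin v4.32.0) has the fixed-field theorem for (infinite) Galois extensions
(`InfiniteGalois.mem_range_algebraMap_iff_fixed`, `IsGalois.fixedField_top`) but `ℂ/F` is not
algebraic; searched `lean search 'fixedField|fixed_apply|≃\+\* ℂ'` — nothing for `Aut(ℂ)`.
The elementary lemma `not_mem_adjoin_sq_of_transcendental` (`z ∉ F(z²)` for transcendental `z`)
is re-proved here in six lines rather than imported from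
`AlgebraicGeometry/Resolution/ValuationDefectExample.lean` (`not_mem_adjoin_pow_of_transcendental`,
general `n`), to keep the imports of this field-theory file inside `FieldTheory`.

## References

* S. Lang, *Algebra*, rev. 3rd ed., GTM 211, Springer 2002, Ch. V §2 (extension of embeddings),
  Ch. VIII §1 (transcendence bases). [Lang2002]
* D. A. Cox, *Primes of the form x² + ny²*, 2nd ed., Wiley 2013, §10.C, proof of Thm. 10.23
  (PDF p. 226). [Cox2013]
-/

noncomputable section

open Cardinal Polynomial IntermediateField

namespace Literature.FieldTheory.AlgClosed

/-! ### Extension of embeddings of countable subfields of `ℂ` -/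

/-- **Every embedding of a countable subfield `F ⊆ ℂ` into `ℂ` extends to an automorphism of `ℂ`**:
for `φ : F →+* ℂ` there is `σ ∈ Aut(ℂ)` with `σ|_F = φ` (the subfield form of
`Complex.exists_ringEquiv_apply_eq_ringHom`; Lang, *Algebra*, Ch. VIII §1). [folklore] -/
theorem Complex.exists_ringEquiv_apply_eq_of_subfield (F : Subfield ℂ) (hF : #F ≤ ℵ₀)
    (φ : F →+* ℂ) : ∃ σ : ℂ ≃+* ℂ, ∀ x : F, σ x = φ x := by
  have hΩ : ℵ₀ < #ℂ := by rw [Cardinal.mk_complex]; exact Cardinal.aleph0_lt_continuum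
  exact exists_ringEquiv_apply_eq hΩ hF F.subtype φ

/-- A subfield of `ℂ` which is algebraic over `ℚ` is countable (Mathlib
`Algebra.IsAlgebraic.cardinalMk_le_max`: an algebraic extension of a countable field is
countable). [folklore] -/
theorem Subfield.cardinalMk_le_aleph0_of_isAlgebraic (F : Subfield ℂ) [Algebra.IsAlgebraic ℚ F] :
    #F ≤ ℵ₀ :=
  (Algebra.IsAlgebraic.cardinalMk_le_max ℚ F).trans (by simp)

/-- The field `F(s)` generated over a countable subfield `F ⊆ ℂ` by a finite set `s` is countable.
[folklore] -/
theorem cardinalMk_adjoin_subfield_le_aleph0 (F : Subfield ℂ) (hF : #F ≤ ℵ₀) {s : Set ℂ}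
    (hs : s.Finite) : #(adjoin F s) ≤ ℵ₀ := by
  refine (cardinalMk_adjoin_le (F := F) s).trans ?_
  rw [sup_le_iff, sup_le_iff]
  exact ⟨⟨hF, hs.lt_aleph0.le⟩, le_rfl⟩

/-! ### Moving an element outside `F` by an automorphism fixing `F` -/

/-- A transcendental element `z` over a field `F` does not lie in `F(z²)`: `z = r(z²)/s(z²)` would
give the polynomial identity `X·s(X²) = r(X²)`, impossible by comparing odd coefficients
(re-proof, for `n = 2`, of the tree's `not_mem_adjoin_pow_of_transcendental`). [folklore] -/
theorem not_mem_adjoin_sq_of_transcendental {F E : Type*} [Field F] [Field E] [Algebra F E]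
    {z : E} (hz : Transcendental F z) : z ∉ F⟮z ^ 2⟯ := by
  have htr := transcendental_iff.mp hz
  intro h
  rw [mem_adjoin_simple_iff] at h
  obtain ⟨r, s, h⟩ := h
  rw [← expand_aeval 2 r z, ← expand_aeval 2 s z] at h
  by_cases hs : aeval z (expand F 2 s) = 0
  · rw [hs, div_zero] at h
    exact X_ne_zero (htr X (by rw [aeval_X, h]))
  · have hzero : X * expand F 2 s - expand F 2 r = 0 := by
      refine htr _ ?_
      rw [map_sub, map_mul, aeval_X, (eq_div_iff hs).mp h, sub_self]
    have hs0 : s = 0 := by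
      ext k
      have hk := congrArg (fun q : F[X] ↦ q.coeff (k * 2 + 1)) hzero
      simp only [coeff_sub, coeff_zero, coeff_X_mul, coeff_expand_mul two_pos] at hk
      rw [coeff_expand two_pos, if_neg (by omega), sub_zero] at hk
      rw [hk, coeff_zero]
    exact hs (by rw [hs0, map_zero, map_zero])

/-- **An algebraic element outside a countable subfield `F ⊆ ℂ` is moved by some automorphism of
`ℂ` fixing `F`**: if `z` is algebraic over `F` and `z ∉ F`, its minimal polynomial over `F` is
separable of degree `≥ 2`, so has a second complex root `w ≠ z`; the `F`-embedding `F(z) → ℂ`,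
`z ↦ w` (Mathlib `IntermediateField.algHomAdjoinIntegralEquiv`) extends to `ℂ` because `F(z)` is
countable (`exists_ringEquiv_apply_eq`). (Lang, *Algebra*, Ch. V §2 and Ch. VIII §1.) [folklore] -/
theorem Complex.exists_ringEquiv_fix_apply_ne_of_isIntegral (F : Subfield ℂ) (hF : #F ≤ ℵ₀)
    {z : ℂ} (hzi : IsIntegral F z) (hz : z ∉ F) :
    ∃ σ : ℂ ≃+* ℂ, (∀ x ∈ F, σ x = x) ∧ σ z ≠ z := by
  have hsep : IsSeparable F z := (minpoly.irreducible hzi).separable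
  have hsplit : ((minpoly F z).map (algebraMap F ℂ)).Splits := IsAlgClosed.splits _
  have hbot : z ∉ (⊥ : Subalgebra F ℂ) := by
    intro hmem
    obtain ⟨x, hx⟩ := Algebra.mem_bot.mp hmem
    exact hz (hx ▸ x.2)
  obtain ⟨w, hne, hconj⟩ := (notMem_iff_exists_ne_and_isConjRoot hsep hsplit).mp hbot
  have hw : w ∈ (minpoly F z).aroots ℂ := by
    rw [mem_aroots]
    exact ⟨minpoly.ne_zero hzi, hconj.aeval_eq_zero⟩
  set ψ : F⟮z⟯ →ₐ[F] ℂ := (algHomAdjoinIntegralEquiv F hzi).symm ⟨w, hw⟩ with hψ_def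
  have hψ : ψ (AdjoinSimple.gen F z) = w :=
    algHomAdjoinIntegralEquiv_symm_apply_gen F hzi ⟨w, hw⟩
  have hcard : #F⟮z⟯ ≤ ℵ₀ :=
    cardinalMk_adjoin_subfield_le_aleph0 F hF (Set.finite_singleton z)
  have hΩ : ℵ₀ < #ℂ := by rw [Cardinal.mk_complex]; exact Cardinal.aleph0_lt_continuum
  obtain ⟨σ, hσ⟩ := exists_ringEquiv_apply_eq hΩ hcard (algebraMap F⟮z⟯ ℂ) ψ.toRingHom
  refine ⟨σ, fun x hx ↦ ?_, ?_⟩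
  · have h := hσ (algebraMap F F⟮z⟯ ⟨x, hx⟩)
    rw [AlgHom.toRingHom_eq_coe, RingHom.coe_coe, AlgHom.commutes] at h
    exact h
  · have h := hσ (AdjoinSimple.gen F z)
    rw [AdjoinSimple.algebraMap_gen, AlgHom.toRingHom_eq_coe, RingHom.coe_coe, hψ] at h
    rw [h]
    exact hne.symm

/-- **Every element outside a countable subfield `F ⊆ ℂ` is moved by some automorphism of `ℂ`
fixing `F` pointwise.** The algebraic case is `Complex.exists_ringEquiv_fix_apply_ne_of_isIntegral`;
a transcendental `z` is algebraic (a root of `X² − z²`) over the countable subfield `F(z²)`, which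
does not contain it (`not_mem_adjoin_sq_of_transcendental`), and an automorphism fixing `F(z²)`
fixes `F`. (Lang, *Algebra*, Ch. VIII §1.) [folklore] -/
theorem Complex.exists_ringEquiv_fix_apply_ne (F : Subfield ℂ) (hF : #F ≤ ℵ₀) {z : ℂ}
    (hz : z ∉ F) : ∃ σ : ℂ ≃+* ℂ, (∀ x ∈ F, σ x = x) ∧ σ z ≠ z := by
  by_cases hzi : IsIntegral F z
  · exact Complex.exists_ringEquiv_fix_apply_ne_of_isIntegral F hF hzi hz
  · have htr : Transcendental F z := fun h ↦ hzi h.isIntegral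
    set F₁ : Subfield ℂ := (F⟮z ^ 2⟯).toSubfield with hF₁_def
    have hmem : ∀ x : ℂ, x ∈ F₁ ↔ x ∈ F⟮z ^ 2⟯ := fun x ↦ Iff.rfl
    have hF₁ : #F₁ ≤ ℵ₀ :=
      cardinalMk_adjoin_subfield_le_aleph0 F hF (Set.finite_singleton (z ^ 2))
    have hz1 : z ∉ F₁ := fun h ↦ not_mem_adjoin_sq_of_transcendental htr ((hmem z).mp h)
    have hz2 : z ^ 2 ∈ F₁ := (hmem _).mpr (mem_adjoin_simple_self F (z ^ 2))
    have hzi1 : IsIntegral F₁ z := by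
      refine ⟨X ^ 2 - C ⟨z ^ 2, hz2⟩, monic_X_pow_sub_C _ two_ne_zero, ?_⟩
      simp only [eval₂_sub, eval₂_X_pow, eval₂_C]
      exact sub_eq_zero.mpr rfl
    obtain ⟨σ, hfix, hne⟩ := Complex.exists_ringEquiv_fix_apply_ne_of_isIntegral F₁ hF₁ hzi1 hz1
    refine ⟨σ, fun x hx ↦ hfix x ?_, hne⟩
    exact (hmem x).mpr ((adjoin F {z ^ 2}).algebraMap_mem ⟨x, hx⟩)

/-- **The fixed field of `Aut(ℂ/F)` is `F`** for a countable subfield `F ⊆ ℂ`: a complex number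
fixed by every automorphism of `ℂ` that fixes `F` pointwise lies in `F`
(`Complex.exists_ringEquiv_fix_apply_ne`, contrapositive). For `F = ℚ` compare the tree's
`exists_ratCast_eq_of_forall_ringEquiv`. (Lang, *Algebra*, Ch. VIII §1; Shimura, *Introduction to
the arithmetic theory of automorphic functions*, §6.8, use of `Aut(ℂ)`.) [folklore] -/
theorem Complex.mem_subfield_of_forall_ringEquiv (F : Subfield ℂ) (hF : #F ≤ ℵ₀) {z : ℂ}
    (h : ∀ σ : ℂ ≃+* ℂ, (∀ x ∈ F, σ x = x) → σ z = z) : z ∈ F := by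
  by_contra hz
  obtain ⟨σ, hfix, hne⟩ := Complex.exists_ringEquiv_fix_apply_ne F hF hz
  exact hne (h σ hfix)

end Literature.FieldTheory.AlgClosed

end
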